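import Summits.QuantumAdvantage.QuantumAdvantage.Theorems.HintDialTable

/-!
# HintDialLowDegree — module 8/10 of the HintDial THEOREMS package (cell decomp-qadv, lens-3 generation 6)

§8: the LOW-DEGREE TRANSFER — Razborov–Smolensky relative to a finite instance set (`exists_good_seed_on`, `razborov_smolensky_on`), `LowDegHard p Q → Q ∉ promiseLift (AC0Mod p)`, and the dial / the blocker through it (`hintRungNU_of_lowDegHard`, `hintRung_two_of_lowDegHard`, `rungA_of_lowDegHard`).

Provenance: split of the farm-checked single file `HintDialTheorems.lean` (HOME/decomp-qadv-lens-3/g6/tree/; rc 0 · no proof holes ·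
axioms ⊆ {propext, Classical.choice, Quot.sound}); mathematical record: HOME/decomp-qadv-lens-3/g6/NODE-g6.md.  Modules in order:
HintDialDuality → HintDialLevels → HintDialAutomaton → HintDialLeakLaw → HintDialPlanting → HintDialClosure → HintDialTable → HintDialLowDegree → HintDialAnfLadder → HintDialCovariance (each imports its predecessor).  Namespace `Summit.QuantumAdvantage.QuantumAdvantage.Theorems.HintDial`.
-/

set_option linter.dupNamespace false

noncomputable section

namespace Summit.QuantumAdvantage.QuantumAdvantage.Theorems.HintDial

open Summit.QuantumAdvantage.QuantumAdvantage.Theses.AnfPresentation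
  (RungA LiftA NearExactIsExact SignedExactSliceIsLift AnfEquiv RungANonuniform)

open Finset
open Literature.Computability.Complexity
open Literature.Computability.QuantumComplexity
open Literature.Computability.MetaComplexity
open _root_.Computability (encodeNat)
/-! ## §8 The low-degree transfer: Razborov–Smolensky RELATIVE to a planted instance set

`razborov_smolensky` in the tree counts the exceptional inputs over the whole cube `{0,1}ᴺ`; a promise problem lives on a sparse
structured instance set, so we re-run Smolensky's averaging over an arbitrary `Finset` of inputs (`exists_good_seed_on`,
`razborov_smolensky_on`: some seed errs on at most `size · |S| / p^ℓ` points OF `S`).  Consequence (`not_promiseLift_AC0Mod_of_lowDegHard`):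
a promise problem whose answer bit admits, on suitable finite instance sets, NO `p^{-ℓ}·poly`-accurate approximant of degree `((p-1)ℓ)^d`
over `𝔽_p` is outside `promiseLift AC⁰[p]` — the algebraic (and only known) road to the characteristic-`2` cells of the dial. -/

section LowDegree

open Literature.Computability.Complexity.GateList
open Literature.Computability.MetaComplexity.Smolensky
open scoped Classical

variable {n : ℕ} {p : ℕ} [Fact p.Prime]

/-- **Some seed errs on few inputs OF `S`** (Smolensky's averaging, relative to a finite instance set). -/
theorem exists_good_seed_on (C : Circuit (Fin n)) (hC : C.IsOver (accBasis p)) (ℓ : ℕ) (S : Finset (Fin n → Bool)) :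
    ∃ ω : Fin C.gates.length → Fin ℓ → Fin C.maxFanIn → ZMod p,
      (S.filter fun x : Fin n → Bool =>
          ∃ j, j < C.gates.length ∧ GateErr ℓ (reader ω) C x j).card * p ^ ℓ ≤
        C.gates.length * S.card := by
  classical
  set s := C.gates.length with hs
  set L : Type := Fin ℓ → Fin C.maxFanIn → ZMod p with hL
  -- per gate and input: few global seeds err
  have hloc : ∀ (j : Fin s) (x : Fin n → Bool),
      (univ.filter fun ω : Fin s → L => GateErr ℓ (reader ω) C x j).card * p ^ ℓ ≤
        Fintype.card (Fin s → L) := by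
    intro j x
    have hj : (j : ℕ) < C.gates.length := j.isLt
    have hiff : ∀ ω : Fin s → L, GateErr ℓ (reader ω) C x j ↔
        LocErr ℓ (lreader (ω j)) C.gates[(j : ℕ)] (trueArgs C x j hj) := by
      intro ω
      rw [← reader_apply ω j]
      exact ⟨fun ⟨_, h⟩ => h, fun h => ⟨hj, h⟩⟩
    have hP := card_locErr_mul_le ℓ C.maxFanIn C.gates[(j : ℕ)] (hC _ (List.getElem_mem hj))
      (BT.arity_le_maxFanIn C (List.getElem_mem hj)) (trueArgs C x j hj)
    have hcoord := card_filter_apply_mul j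
      (fun c : L => LocErr ℓ (lreader c) C.gates[(j : ℕ)] (trueArgs C x j hj))
    rw [Finset.filter_congr fun ω _ => hiff ω]
    have hLpos : 0 < Fintype.card L := Fintype.card_pos
    refine Nat.le_of_mul_le_mul_left ?_ hLpos
    calc Fintype.card L * ((univ.filter fun ω : Fin s → L =>
            LocErr ℓ (lreader (ω j)) C.gates[(j : ℕ)] (trueArgs C x j hj)).card * p ^ ℓ)
        = (univ.filter fun c : L =>
            LocErr ℓ (lreader c) C.gates[(j : ℕ)] (trueArgs C x j hj)).card * p ^ ℓ *
            Fintype.card (Fin s → L) := by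
          rw [← mul_assoc, mul_comm (Fintype.card L), hcoord]
          ring
      _ ≤ Fintype.card L * Fintype.card (Fin s → L) := Nat.mul_le_mul_right _ hP
  -- averaging over the seed, summing over `x ∈ S` only
  by_contra hall
  push Not at hall
  have hsum : ∀ ω : Fin s → L,
      (S.filter fun x : Fin n → Bool => ∃ j, j < s ∧ GateErr ℓ (reader ω) C x j).card ≤
        ∑ j : Fin s, (S.filter fun x : Fin n → Bool => GateErr ℓ (reader ω) C x j).card := by
    intro ω
    refine (Finset.card_le_card ?_).trans Finset.card_biUnion_le
    intro x hx
    simp only [Finset.mem_filter] at hx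
    obtain ⟨hxS, j, hj, hE⟩ := hx
    exact Finset.mem_biUnion.2 ⟨⟨j, hj⟩, Finset.mem_univ _, by simpa using ⟨hxS, hE⟩⟩
  have htotal : ∑ ω : Fin s → L, (S.filter fun x : Fin n → Bool =>
      ∃ j, j < s ∧ GateErr ℓ (reader ω) C x j).card * p ^ ℓ ≤
        s * S.card * Fintype.card (Fin s → L) := by
    calc ∑ ω : Fin s → L, (S.filter fun x : Fin n → Bool =>
          ∃ j, j < s ∧ GateErr ℓ (reader ω) C x j).card * p ^ ℓ
        ≤ ∑ ω : Fin s → L, (∑ j : Fin s,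
            (S.filter fun x : Fin n → Bool => GateErr ℓ (reader ω) C x j).card) * p ^ ℓ :=
          Finset.sum_le_sum fun ω _ => Nat.mul_le_mul_right _ (hsum ω)
      _ = ∑ j : Fin s, ∑ x ∈ S,
            (univ.filter fun ω : Fin s → L => GateErr ℓ (reader ω) C x j).card * p ^ ℓ := by
          simp only [Finset.card_filter, Finset.sum_mul]
          rw [Finset.sum_comm]
          refine Finset.sum_congr rfl fun j _ => ?_
          rw [Finset.sum_comm]
      _ ≤ ∑ _j : Fin s, ∑ _x ∈ S, Fintype.card (Fin s → L) :=
          Finset.sum_le_sum fun j _ => Finset.sum_le_sum fun x _ => hloc j x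
      _ = s * S.card * Fintype.card (Fin s → L) := by
          simp only [Finset.sum_const, smul_eq_mul, Finset.card_univ, Fintype.card_fin]
          ring
  have hlower : ∑ ω : Fin s → L, (s * S.card + 1) ≤ ∑ ω : Fin s → L,
      (S.filter fun x : Fin n → Bool => ∃ j, j < s ∧ GateErr ℓ (reader ω) C x j).card * p ^ ℓ :=
    Finset.sum_le_sum fun ω _ => hall ω
  rw [Finset.sum_const, smul_eq_mul, Finset.card_univ] at hlower
  have hpos : 0 < Fintype.card (Fin s → L) := Fintype.card_pos
  nlinarith [hlower.trans htotal]

/-- **Razborov–Smolensky on an instance set.** For a prime `p`, a circuit `C` over `accBasis p` on `n` inputs, `ℓ ≥ 1` and ANY finite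
set `S` of inputs there are `P : {0,1}ⁿ → 𝔽_p` of degree `≤ ((p-1)ℓ)^{acDepth C}` and `E ⊆ S` with `|E|·p^ℓ ≤ size(C)·|S|` such that
`P x = [C x]` on `S ∖ E`. -/
theorem razborov_smolensky_on (C : Circuit (Fin n)) (hC : C.IsOver (accBasis p)) {ℓ : ℕ} (hℓ : 1 ≤ ℓ)
    (S : Finset (Fin n → Bool)) :
    ∃ (P : CubeFn (ZMod p) n) (E : Finset (Fin n → Bool)),
      P ∈ lowDeg (ZMod p) n (((p - 1) * ℓ) ^ C.acDepth) ∧ E ⊆ S ∧ E.card * p ^ ℓ ≤ C.size * S.card ∧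
        ∀ x ∈ S, x ∉ E → P x = bit p (C.eval x) := by
  classical
  obtain ⟨ω, hω⟩ := exists_good_seed_on C hC ℓ S
  refine ⟨apx ℓ (reader ω) C,
    S.filter fun x : Fin n → Bool => ∃ j, j < C.gates.length ∧ GateErr ℓ (reader ω) C x j,
    apx_mem_lowDeg ℓ hℓ _ C, Finset.filter_subset _ _, hω, fun x hxS hx => ?_⟩
  refine apx_eq_bit_eval ℓ _ C x fun j hj hE => hx ?_
  simp only [Finset.mem_filter]
  exact ⟨hxS, j, hj, hE⟩

end LowDegree

section LowDegreeTransfer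

open Literature.Computability.MetaComplexity.Smolensky
open scoped Classical

/-- **Low-degree hardness of a promise problem against `𝔽_p`-polynomials** (the hypothesis shape the Razborov–Smolensky method
consumes): for every depth `d` and polynomial size bound `r` there are a length `N`, a trial count `ℓ ≥ 1` and a finite set `S` of
length-`N` PROMISE instances on which EVERY polynomial of degree `≤ ((p-1)ℓ)^d` over `𝔽_p` misclassifies MORE than `r(N)·|S|/p^ℓ`
instances. -/
def LowDegHard (p : ℕ) [Fact p.Prime] (Q : PromiseProblem) : Prop :=
  ∀ (d : ℕ) (r : Polynomial ℕ), ∃ (N ℓ : ℕ), 1 ≤ ℓ ∧ ∃ S : Finset (Fin N → Bool),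
    (∀ x ∈ S, List.ofFn x ∈ Q.yes ∨ List.ofFn x ∈ Q.no) ∧
      ∀ P ∈ lowDeg (ZMod p) N (((p - 1) * ℓ) ^ d),
        r.eval N * S.card < p ^ ℓ * (S.filter fun x => P x ≠ bit p (decide (List.ofFn x ∈ Q.yes))).card

/-- ★★ THE LOW-DEGREE TRANSFER: `LowDegHard p Q → Q ∉ promiseLift AC⁰[p]` (for a disjoint promise `Q`). -/
theorem not_promiseLift_AC0Mod_of_lowDegHard {p : ℕ} [hp : Fact p.Prime] (Q : PromiseProblem) (hQ : Q.Disjoint)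
    (h : LowDegHard p Q) : Q ∉ promiseLift (AC0Mod p) := by
  rintro ⟨L, ⟨d, r, C, hC, hDec⟩, hyes, hno⟩
  obtain ⟨N, ℓ, hℓ, S, hSQ, hhard⟩ := h d r
  obtain ⟨P, E, hP, hES, hE, hagree⟩ := razborov_smolensky_on (C N) (hC N).1 hℓ S
  have hpos : 0 < (p - 1) * ℓ :=
    Nat.pos_of_ne_zero (Nat.mul_ne_zero (Nat.sub_ne_zero_of_lt hp.out.one_lt) (by omega))
  have hP' : P ∈ lowDeg (ZMod p) N (((p - 1) * ℓ) ^ d) :=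
    lowDeg_mono (Nat.pow_le_pow_right hpos (hC N).2.1) hP
  have key := hhard P hP'
  -- the misclassified instances lie in the exceptional set
  have hsub : (S.filter fun x => P x ≠ bit p (decide (List.ofFn x ∈ Q.yes))) ⊆ E := by
    intro x hx
    rw [Finset.mem_filter] at hx
    by_contra hxE
    apply hx.2
    rw [hagree x hx.1 hxE, hDec.eval_eq]
    congr 1
    rcases hSQ x hx.1 with hy | hn'
    · rw [(Set.mem_iff_boolIndicator _ _).1 (hyes hy), decide_eq_true hy]
    · have hny : List.ofFn x ∉ Q.yes := fun hy => Set.disjoint_left.1 hQ hy hn'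
      rw [(Set.notMem_iff_boolIndicator _ _).1 (hno hn'), decide_eq_false hny]
  have h1 : p ^ ℓ * (S.filter fun x => P x ≠ bit p (decide (List.ofFn x ∈ Q.yes))).card ≤ p ^ ℓ * E.card :=
    Nat.mul_le_mul_left _ (Finset.card_le_card hsub)
  have h2 : p ^ ℓ * E.card ≤ (C N).size * S.card := by rw [mul_comm]; exact hE
  have h3 : (C N).size * S.card ≤ r.eval N * S.card := Nat.mul_le_mul_right _ (hC N).2.2
  omega

end LowDegreeTransfer

/-! ### §8b The dial through the low-degree transfer: every characteristic-`2` cell `HintRungNU k` (hence `HintRung k`, hence at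
`k = 2` the W-piece and at `k = 1` the blocker) FOLLOWS from low-degree hardness of its slice — the typed first stub of the
Razborov–Smolensky road.  (By the LEAK LAW of §4 no instance set drawn from the separated linear-key Maiorana–McFarland class can
witness it at levels `≤ 2`: there the answer IS a polynomial of degree `≤ 3` in the instance bits.) -/

/-- ★★ `LowDegHard 2 (HintSlice k) → HintRungNU k`: the transfer applied to the dial (every level). -/
theorem hintRungNU_of_lowDegHard (k : ℕ) (h : LowDegHard 2 (HintSlice k)) : HintRungNU k :=
  haveI : Fact (Nat.Prime 2) := ⟨Nat.prime_two⟩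
  not_promiseLift_AC0Mod_of_lowDegHard (HintSlice k) (hintSlice_disjoint k) h

/-- HintDial helper `hintRung_of_lowDegHard` (lens-3 g6 HintDial THEOREMS package; see the enclosing section docstring). -/
theorem hintRung_of_lowDegHard (k : ℕ) (h : LowDegHard 2 (HintSlice k)) : HintRung k :=
  hintRung_of_NU k (hintRungNU_of_lowDegHard k h)

/-- ★ the blocker through the transfer: `LowDegHard 2 (HintSlice 1) → RungANonuniform → RungA`. -/
theorem rungANonuniform_of_lowDegHard (h : LowDegHard 2 (HintSlice 1)) : RungANonuniform :=
  rungANonuniform_iff_hintRungNU_one.2 (hintRungNU_of_lowDegHard 1 h)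

/-- HintDial helper `rungA_of_lowDegHard` (lens-3 g6 HintDial THEOREMS package; see the enclosing section docstring). -/
theorem rungA_of_lowDegHard (h : LowDegHard 2 (HintSlice 1)) : RungA :=
  rungA_of_rungANonuniform (rungANonuniform_of_lowDegHard h)

/-- ★★ PROVED: `LowDegHard 2 (HintSlice 2) → HintRung 2` (the W-piece through the transfer). -/
theorem hintRung_two_of_lowDegHard (h : LowDegHard 2 (HintSlice 2)) : HintRung 2 := hintRung_of_lowDegHard 2 h

end Summit.QuantumAdvantage.QuantumAdvantage.Theorems.HintDial

end
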